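import Literature.NumberTheory.NumberFields.GenusCoinvariantIndexLayerOne
import Literature.NumberTheory.IwasawaTheory.ClassGroupPRankLeOfRelationTwoRamified
import Literature.NumberTheory.IwasawaTheory.ZpExtensionLayerRamificationDichotomy
import Literature.NumberTheory.IwasawaTheory.ZpExtensionLayerTotallyRamifiedPrime
import Literature.NumberTheory.IwasawaTheory.ClassGroupPRankLayerOneGenusJump
import Literature.NumberTheory.IwasawaTheory.ClassGroupPRankLeOneOfNonNormUnitLayerTwo
import Literature.NumberTheory.IwasawaTheory.ClassGroupPRankLeOfRelationTwoLayer
import HarnessLib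

/-!
# THE RELATION DOOR FROM THE FIRST LAYER: in a `ℤ_p`-tower with Fukuda index `0` (ANY number of ramified primes, ANY `h_K`),
# `rank_p Cl(K_1) ≤ 1` + the generator certificate + ONE relation of order `d ≤ p^n − 2` at a layer `n ≥ 1` ⟹ `μ = 0`, `λ ≤ d`, all ranks `≤ d`;
# at `p = 2`: `2 ∤ h_K`, at most THREE primes ramified in `K_1`, ONE unit of `K` outside `N_{K_1/K} K_1ˣ`

Topic `NumberTheory/IwasawaTheory` (namespace = path).  THEOREMS ONLY (no definition, no named fact, no instance, no `sorry`); unconditional.  Written by the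
prover seat `bsd-line-att-p3` g53 (cell `bsd-f1-sign2`, WIDTH-5 attach on route `AlignedTransportAtTwo`, crux C2 stmt-BirchSwinnertonDyer-22298; `--supports`, closes
nothing).  Assembly of this lineage's `ClassGroupPRankLeOfRelationCoinvariant` (g48/g49: the relation door with the coinvariant index `[Cl(K_n) : Cl^p·⟨σx·x⁻¹⟩] ≤ p`
displayed) with `NumberFields/GenusCoinvariantIndexLayerOne` (g53: for `L/K` cyclic with every ramified prime TOTALLY ramified that index does not grow above the layer
`K_1` of degree `p` — Washington §13.3 Lemma 13.15/13.18 read modulo `𝔪 = (p, T)` at finite level: `A_n/𝔪A_n = A_1/𝔪A_1` for `n ≥ 1`).  Compared with g49's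
`ClassGroupPRankLeOfRelationTwoRamified` (`p ∤ h_K`, at most TWO ramified primes) the number of ramified primes and `h_K` are now arbitrary; the price is ONE datum of
the first layer, `rank_p Cl(K_1) ≤ 1` (or directly: the `Gal(K_1/K)`-coinvariants of `Cl(K_1)/p` are cyclic).

* `index_range_pow_layer_eq_pow_classGroupPRank` — `[Cl(K_n) : Cl(K_n)^p] = p^{rank_p Cl(K_n)}` (dictionary).
* ★★★ `classGroupPRank_le_of_relation_of_layer_one` — ONE LAYER: `TotallyRamifiedFrom κ 0`, `1 ≤ n`, `[Cl(K_1) : Cl^p·⟨τc·c⁻¹⟩] ≤ p`, `σ` a generator of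
  `Gal(K_n/K)`, a class `c ∉ σ(b)b⁻¹·Cl^p`, ONE relation `∏ σ^i(c)^{f_i} = 1` with `∑ f_i X^i = (X−1)^d·u + p·g`, `p ∤ u(1)` ⟹ **`rank_p Cl(K_n) ≤ d`**;
  `…_of_classGroupPRank_one_le_one` — the same from **`rank_p Cl(K_1) ≤ 1`**.
* ★★★ `classicalMuVanishes_and_classicalLambda_le_of_relation_of_classGroupPRank_one_le_one` — moreover `d + 2 ≤ p^n` ⟹ **`rank_p Cl(K_m) ≤ d` for every `m`,
  `μ(κ) = 0`, `λ(κ) ≤ d`** (small-rank criterion, tree `classGroupPRank_le_of_lt_pow_sub_one` / `classicalLambda_le_of_forall_classGroupPRank_le`).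
* `p = 2`: `classGroupPRank_one_add_two_le_ncard_of_not_mem` — `2 ∤ h_K` and ONE unit of `K` outside `N_{K_1/K} K_1ˣ` ⟹ **`rank₂ Cl(K_1) + 2 ≤ t₁`** (`t₁` = number of
  primes of `K` ramified in `K_1`; the exact genus count `r_1 + 1 + ord₂ [E_K : E_K ∩ N] = t₁` of `ClassGroupPRankLayerOneGenusJump`); hence `rank₂ Cl(K_1) ≤ 1` when
  `t₁ ≤ 3`: ★★★ `classicalMuVanishes_and_classicalLambda_le_of_relation_of_not_mem_layer_one`.
* ★★★ `classicalMuVanishes_two_of_relation_of_genusCert_of_sub_three_mem_layer_one` — BASE-FIELD CURRENCY for an odd-degree `K` with `2 ∤ d_K` and AT MOST THREE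
  primes above `2`, `κ` cyclotomic, `2 ∤ h_K`: a dyadic prime `𝔭'` with `𝓞_K/𝔭' = 𝔽₂` and a unit `ε ≡ ±3 (mod 𝔭'³)` (the non-norm unit, tree
  `unitsIncl_unitsMap_not_mem_map_norm_of_{sub,add}_three_mem_pow_three`); a dyadic prime `𝔭` with `𝓞_K/𝔭 = 𝔽₂`, every unit `≡ ±1 (mod 𝔭³)` and the GENUS
  CERTIFICATE `(𝔄, k, π)` for the class `c ∈ Cl(K_m)` (tree `not_exists_eq_conj_div_mul_sq_of_genusCert_layer`); `σ`, ONE relation of order `d`, `d + 2 ≤ 2^m` ⟹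
  **`rank₂ Cl(K_l) ≤ d ∀ l`, `μ₂(κ) = 0`, `λ₂(κ) ≤ d`**.

HONEST SCOPE: classical (Washington §13.3 at finite level + genus theory); nothing specific to any summit; no class group of any field is computed here; BSD is not
advanced by this file.  USE (cell bsd-f1-sign2, crux C2): the SPLIT stratum `Δ_W ≡ 1 (mod 8)` of the cubic `2`-division fields `ℚ(β)` (`2 = 𝔭₁𝔭₂𝔭₃`, `h` odd,
`t₁ = 3`), where neither g49's two-prime genus cyclicity nor Chevalley's bound at layer `≥ 2` (`#Cl(K_2)^G ≥ 4`) applies: the door fires as soon as ONE dyadic embedding of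
the fundamental unit is `≢ ±1 (mod 8)` (then exactly two are, by the product formula, and the genus certificate is read at the third prime).

## References

* L. C. Washington, *Introduction to Cyclotomic Fields*, 2nd ed. (1997), §13.3 Lemmas 13.15, 13.18, Prop. 13.22–13.23. [Washington1997]
* G. Gras, *Class Field Theory* (2003), IV.4. [Gras2003]
* S. Lang, *Cyclotomic Fields I and II* (1990), Ch. 13 §4 Lemma 4.1–4.2. [Lang1990]
* T. Fukuda, *Remarks on `ℤ_p`-extensions of number fields*, Proc. Japan Acad. 70 A (1994), Thm. 1. [Fukuda1994]
* O. T. O'Meara, *Introduction to Quadratic Forms* (1963), §63B. [Omeara1963]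
* J. Neukirch, *Algebraic Number Theory* (1999), Ch. I §9 (9.6), Ch. III (2.12). [NeukirchANT1999]
-/

set_option autoImplicit false

noncomputable section

open Polynomial Finset

namespace Literature.NumberTheory.IwasawaTheory

open scoped NumberField nonZeroDivisors
open NumberField IsDedekindDomain Field Literature.NumberTheory.EllipticCurves Literature.NumberTheory.NumberFields
  Literature.NumberTheory.NumberFields.AmbiguousClass Literature.NumberTheory.GaloisRepresentations
  Literature.NumberTheory.GaloisRepresentations.Herbrand Literature.NumberTheory.GaloisRepresentations.MinkowskiUnit
  Literature.NumberTheory.GaloisRepresentations.CyclicNormIndex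

/-! ## §1 Any prime `p`: the door from the first layer -/

section AnyPrime

variable {K : Type} [Field K] [NumberField K] {p : ℕ} [hp : Fact p.Prime]

/-- An automorphism of a layer over `K` fixes the elements of the layer `K_0 = K`. [folklore] -/
private theorem apply_eq_of_mem_layer_zero (κ : ZpExtension K p) (m : ℕ) (τ : (κ.layer m) ≃ₐ[K] (κ.layer m))
    (y : κ.layer m) (hy : ((y : κ.layer m) : AlgebraicClosure K) ∈ κ.layer 0) : τ y = y := by
  rw [κ.layer_zero, IntermediateField.mem_bot] at hy
  obtain ⟨k, hk⟩ := hy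
  have : y = algebraMap K (κ.layer m) k := Subtype.ext hk.symm
  rw [this, AlgEquiv.commutes]

omit [NumberField K] in
/-- **Dictionary: `[Cl(K_n) : Cl(K_n)^p] = p^{rank_p Cl(K_n)}`** (`Cl/Cl^p` is an elementary abelian `p`-group of order `p^{rank}`, Fukuda's `rank(A_n)`).
[cite: Fukuda1994, p. 264 (definition of `rank`)] [cite: Lang1990, Ch. 13 §2] -/
theorem index_range_pow_layer_eq_pow_classGroupPRank (κ : ZpExtension K p) (n : ℕ) [NumberField (κ.layer n)] :
    (powMonoidHom p : ClassGroup (𝓞 (κ.layer n)) →* ClassGroup (𝓞 (κ.layer n))).range.index = p ^ classGroupPRank κ n := by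
  classical
  have hP : IsPGroup p (ClassGroup (𝓞 (κ.layer n)) ⧸ (powMonoidHom p : ClassGroup (𝓞 (κ.layer n)) →* ClassGroup (𝓞 (κ.layer n))).range) := by
    intro q
    obtain ⟨c, rfl⟩ := QuotientGroup.mk_surjective q
    refine ⟨1, ?_⟩
    rw [pow_one, ← QuotientGroup.mk_pow, QuotientGroup.eq_one_iff]
    exact ⟨c, rfl⟩
  obtain ⟨c, hc⟩ := IsPGroup.iff_card.mp hP
  rw [classGroupPRank_def, hc, padicValNat.prime_pow, Subgroup.index_eq_card, hc]

omit [NumberField K] in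
/-- `[Cl(K_n) : Cl(K_n)^p · H] ≤ p^{rank_p Cl(K_n)}` for any subgroup `H` (in particular for Washington's `ω X`-part `H = ⟨τc·c⁻¹⟩`).
[cite: Fukuda1994, p. 264 (definition of `rank`)] [cite: Washington1997, §13.3 Lemma 13.18 (the coinvariant quotient)] -/
theorem index_pow_sup_le_pow_classGroupPRank (κ : ZpExtension K p) (n : ℕ) [NumberField (κ.layer n)] (H : Subgroup (ClassGroup (𝓞 (κ.layer n)))) :
    ((powMonoidHom p : ClassGroup (𝓞 (κ.layer n)) →* ClassGroup (𝓞 (κ.layer n))).range ⊔ H).index ≤ p ^ classGroupPRank κ n := by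
  rw [← index_range_pow_layer_eq_pow_classGroupPRank κ n]
  exact Subgroup.index_antitone le_sup_left

/-- ★★★ **THE RELATION DOOR FROM THE FIRST LAYER (one layer).**  `κ` a `ℤ_p`-extension of `K` with Fukuda index `0` (`TotallyRamifiedFrom κ 0`: every ramified prime is
totally ramified from `K` on — ANY number of them, ANY `h_K`), a layer `n ≥ 1`, and the first-layer datum **`[Cl(K_1) : Cl(K_1)^p · ⟨τc·c⁻¹ : τ ∈ Gal(K_1/K)⟩] ≤ p`**;
`σ` a generator of `Gal(K_n/K)`, a class `c` **not of the form `σ(b)·b⁻¹·e^p`**, ONE RELATION `∏_{i<N} σ^i(c)^{f_i} = 1` with `∑ f_i X^i = (X−1)^d·u + p·g`, `p ∤ u(1)`.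
THEN **`rank_p Cl(K_n) ≤ d`** — the coinvariant index of `Cl(K_n)` is read at the first layer (tree `index_pow_sup_closure_le_of_layer_one`).
[cite: Washington1997, §13.3 Lemmas 13.15, 13.18, Prop. 13.22–13.23] [cite: Gras2003, IV.4] [cite: Lang1990, Ch. 13 §4 Lemma 4.1] -/
theorem classGroupPRank_le_of_relation_of_layer_one (κ : ZpExtension K p) (hκ : TotallyRamifiedFrom κ 0) {n : ℕ} (hn : 1 ≤ n)
    (hidx : ((powMonoidHom p : ClassGroup (𝓞 (κ.layer 1)) →* ClassGroup (𝓞 (κ.layer 1))).range ⊔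
      Subgroup.closure {x | ∃ (τ : (κ.layer 1) ≃ₐ[K] (κ.layer 1)) (c : ClassGroup (𝓞 (κ.layer 1))),
        x = ClassGroup.mulEquiv (AmbiguousClass.intAut τ) c * c⁻¹}).index ≤ p)
    (σ : (κ.layer n) ≃ₐ[K] (κ.layer n)) (hσ : ∀ τ : (κ.layer n) ≃ₐ[K] (κ.layer n), τ ∈ Subgroup.zpowers σ)
    {c : ClassGroup (𝓞 (κ.layer n))}
    (hc : ¬ ∃ b e : ClassGroup (𝓞 (κ.layer n)), c = ClassGroup.mulEquiv (AmbiguousClass.intAut σ) b / b * e ^ p)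
    {N d : ℕ} {f : ℕ → ℤ} {u g : ℤ[X]} (hu : ¬ (p : ℤ) ∣ u.eval 1)
    (hF : (∑ i ∈ range N, C (f i) * X ^ i : ℤ[X]) = (X - 1) ^ d * u + C (p : ℤ) * g)
    (hrel : ∏ i ∈ range N, (ClassGroup.mulEquiv (AmbiguousClass.intAut (σ ^ i)) c) ^ (f i) = 1) :
    classGroupPRank κ n ≤ d := by
  classical
  -- ### the layers `K_1 ⊆ K_n`
  haveI : FiniteDimensional K (κ.layer n) := κ.finiteDimensional_layer_holds n
  haveI : FiniteDimensional K (κ.layer 1) := κ.finiteDimensional_layer_holds 1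
  haveI : NumberField (κ.layer n) := NumberField.of_module_finite K _
  haveI : NumberField (κ.layer 1) := NumberField.of_module_finite K _
  haveI : IsGalois K (κ.layer n) := κ.isGalois_layer_holds n
  haveI : IsGalois K (κ.layer 1) := κ.isGalois_layer_holds 1
  haveI : IsUnramifiedAtInfinitePlaces K (κ.layer n) := κ.isUnramifiedAtInfinitePlaces_layer n
  have h1n : κ.layer 1 ≤ κ.layer n := κ.layer_mono hn
  letI : Algebra (κ.layer 1) (κ.layer n) := (IntermediateField.inclusion h1n).toRingHom.toAlgebra
  haveI : IsScalarTower K (κ.layer 1) (κ.layer n) :=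
    IsScalarTower.of_algebraMap_eq fun x => ((IntermediateField.inclusion h1n).commutes x).symm
  -- `Gal(K_n/K)` is cyclic, `[K_1 : K] = p`
  obtain ⟨ψ, -, hker, -⟩ := κ.exists_cyclicCharacter_layer n
  have hcyc : IsCyclic ((κ.layer n) ≃ₐ[K] (κ.layer n)) := isCyclic_of_cyclicLayer ψ (κ.layer n) hker
  have hdeg1 : Module.finrank K (κ.layer 1) = p := by rw [κ.finrank_layer_holds 1, pow_one]
  -- ### every maximal ideal of `𝓞 K_n` is unramified or totally ramified over `K`
  have hcardI : ∀ (q : Ideal (𝓞 (κ.layer n))) [q.IsMaximal],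
      (∀ g : (κ.layer n) ≃ₐ[K] (κ.layer n), (∀ x : κ.layer n, (x : AlgebraicClosure K) ∈ κ.layer 0 → g x = x) →
        g ∈ q.inertia ((κ.layer n) ≃ₐ[K] (κ.layer n))) → q.ramificationIdx (𝓞 K) = Module.finrank K (κ.layer n) := by
    intro q _ h
    have htop : q.inertia ((κ.layer n) ≃ₐ[K] (κ.layer n)) = ⊤ := by
      rw [eq_top_iff]
      intro g _
      exact h g fun x hx => apply_eq_of_mem_layer_zero κ n g x hx
    rw [← card_inertia_eq_ramificationIdx (κ.layer n) ((κ.layer n) ≃ₐ[K] (κ.layer n)) K q, htop, Subgroup.card_top,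
      IsGalois.card_aut_eq_finrank]
  have htot : ∀ (q : Ideal (𝓞 (κ.layer n))) [q.IsMaximal],
      q.ramificationIdx (𝓞 K) = 1 ∨ q.ramificationIdx (𝓞 K) = Module.finrank K (κ.layer n) := by
    intro q _
    rcases κ.inertia_layer_eq_bot_or_forall_mem hκ le_rfl (Nat.zero_le n) q with h | h
    · left
      rw [← card_inertia_eq_ramificationIdx (κ.layer n) ((κ.layer n) ≃ₐ[K] (κ.layer n)) K q, h, Subgroup.card_bot]
    · exact Or.inr (hcardI q h)
  -- ### one totally ramified prime `Q` of `K_n`, and the prime `P₁ = Q ∩ 𝓞 K` below it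
  obtain ⟨Q, hQmax, hQI⟩ := κ.exists_isMaximal_forall_mem_inertia (n₀ := 0) (n := 0) (m := n) hκ le_rfl (Nat.zero_le n) hn
  haveI := hQmax
  have hQe : Q.ramificationIdx (𝓞 K) = Module.finrank K (κ.layer n) := hcardI Q hQI
  haveI : (Q.under (𝓞 K)).IsMaximal := Ideal.IsMaximal.under (𝓞 K) Q
  have htot₁ : ∀ (q : Ideal (𝓞 (κ.layer n))) [q.IsMaximal], q.under (𝓞 K) = Q.under (𝓞 K) →
      q.ramificationIdx (𝓞 K) = Module.finrank K (κ.layer n) := by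
    intro q _ hq
    haveI : q.LiesOver (Q.under (𝓞 K)) := ⟨hq.symm⟩
    haveI : Q.LiesOver (Q.under (𝓞 K)) := ⟨rfl⟩
    rw [← Ideal.ramificationIdxIn_eq_ramificationIdx (Q.under (𝓞 K)) q ((κ.layer n) ≃ₐ[K] (κ.layer n)),
      Ideal.ramificationIdxIn_eq_ramificationIdx (Q.under (𝓞 K)) Q ((κ.layer n) ≃ₐ[K] (κ.layer n)), hQe]
  -- ### the coinvariant index is read at the first layer
  have hle := index_pow_sup_closure_le_of_layer_one (K := K) (L := κ.layer n) (κ.layer 1) hcyc hdeg1 (Q.under (𝓞 K)) htot₁ htot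
  have hgen : (powMonoidHom p : ClassGroup (𝓞 (κ.layer n)) →* ClassGroup (𝓞 (κ.layer n))).range ⊔
      Subgroup.closure {x | ∃ (τ : (κ.layer n) ≃ₐ[K] (κ.layer n)) (c : ClassGroup (𝓞 (κ.layer n))),
        x = ClassGroup.mulEquiv (AmbiguousClass.intAut τ) c * c⁻¹} ≤
      (powMonoidHom p : ClassGroup (𝓞 (κ.layer n)) →* ClassGroup (𝓞 (κ.layer n))).range ⊔
      Subgroup.closure {x | ∃ x' : ClassGroup (𝓞 (κ.layer n)), x = ClassGroup.mulEquiv (AmbiguousClass.intAut σ) x' * x'⁻¹} :=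
    sup_le_sup_left (closure_smul_div_le_closure_of_mem_zpowers hσ) _
  have hcoinv := (Nat.le_of_dvd (Nat.pos_of_ne_zero Subgroup.index_ne_zero_of_finite) (Subgroup.index_dvd_of_le hgen)).trans
    (hle.trans hidx)
  exact classGroupPRank_le_of_relation_of_index_le κ n σ hcoinv hc hu hF hrel

/-- ★★★ **THE RELATION DOOR FROM `rank_p Cl(K_1) ≤ 1` (one layer).**  As `classGroupPRank_le_of_relation_of_layer_one`, with the first-layer datum replaced by
**`rank_p Cl(K_1) ≤ 1`** (`[Cl(K_1) : Cl^p·⟨τc·c⁻¹⟩] ≤ [Cl(K_1) : Cl(K_1)^p] = p^{rank} ≤ p`).  THEN `rank_p Cl(K_n) ≤ d`.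
[cite: Washington1997, §13.3 Lemmas 13.15, 13.18, Prop. 13.22–13.23] [cite: Gras2003, IV.4] [cite: Lang1990, Ch. 13 §4 Lemma 4.1] -/
theorem classGroupPRank_le_of_relation_of_classGroupPRank_one_le_one (κ : ZpExtension K p) (hκ : TotallyRamifiedFrom κ 0) {n : ℕ} (hn : 1 ≤ n)
    (h1 : classGroupPRank κ 1 ≤ 1)
    (σ : (κ.layer n) ≃ₐ[K] (κ.layer n)) (hσ : ∀ τ : (κ.layer n) ≃ₐ[K] (κ.layer n), τ ∈ Subgroup.zpowers σ)
    {c : ClassGroup (𝓞 (κ.layer n))}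
    (hc : ¬ ∃ b e : ClassGroup (𝓞 (κ.layer n)), c = ClassGroup.mulEquiv (AmbiguousClass.intAut σ) b / b * e ^ p)
    {N d : ℕ} {f : ℕ → ℤ} {u g : ℤ[X]} (hu : ¬ (p : ℤ) ∣ u.eval 1)
    (hF : (∑ i ∈ range N, C (f i) * X ^ i : ℤ[X]) = (X - 1) ^ d * u + C (p : ℤ) * g)
    (hrel : ∏ i ∈ range N, (ClassGroup.mulEquiv (AmbiguousClass.intAut (σ ^ i)) c) ^ (f i) = 1) :
    classGroupPRank κ n ≤ d := by
  haveI : FiniteDimensional K (κ.layer 1) := κ.finiteDimensional_layer_holds 1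
  haveI : NumberField (κ.layer 1) := NumberField.of_module_finite K _
  refine classGroupPRank_le_of_relation_of_layer_one κ hκ hn ?_ σ hσ hc hu hF hrel
  refine (index_pow_sup_le_pow_classGroupPRank κ 1 _).trans ?_
  calc p ^ classGroupPRank κ 1 ≤ p ^ 1 := Nat.pow_le_pow_right hp.out.pos h1
    _ = p := pow_one p

/-- ★★★ **THE RELATION DOOR FROM `rank_p Cl(K_1) ≤ 1` (every layer, `μ = 0`, `λ ≤ d`).**  `κ` a `ℤ_p`-extension of `K` with Fukuda index `0`, **`rank_p Cl(K_1) ≤ 1`**,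
a layer `n ≥ 1` with **`d + 2 ≤ p^n`**, `σ` a generator of `Gal(K_n/K)`, a class `c ∉ σ(b)·b⁻¹·Cl^p` and ONE relation `∏ σ^i(c)^{f_i} = 1` of order `d`
(`∑ f_i X^i = (X−1)^d·u + p·g`, `p ∤ u(1)`).  THEN **`rank_p Cl(K_m) ≤ d` for every `m`, `μ(κ) = 0`, `λ(κ) ≤ d`** — any number of ramified primes, any `h_K`.
[cite: Washington1997, §13.3 Prop. 13.22–13.23] [cite: Fukuda1994, Thm. 1, p. 264] [cite: Gras2003, IV.4] -/
theorem classicalMuVanishes_and_classicalLambda_le_of_relation_of_classGroupPRank_one_le_one (κ : ZpExtension K p) (hκ : TotallyRamifiedFrom κ 0)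
    {n : ℕ} (hn : 1 ≤ n) (h1 : classGroupPRank κ 1 ≤ 1)
    (σ : (κ.layer n) ≃ₐ[K] (κ.layer n)) (hσ : ∀ τ : (κ.layer n) ≃ₐ[K] (κ.layer n), τ ∈ Subgroup.zpowers σ)
    {c : ClassGroup (𝓞 (κ.layer n))}
    (hc : ¬ ∃ b e : ClassGroup (𝓞 (κ.layer n)), c = ClassGroup.mulEquiv (AmbiguousClass.intAut σ) b / b * e ^ p)
    {N d : ℕ} (hd : d + 2 ≤ p ^ n) {f : ℕ → ℤ} {u g : ℤ[X]} (hu : ¬ (p : ℤ) ∣ u.eval 1)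
    (hF : (∑ i ∈ range N, C (f i) * X ^ i : ℤ[X]) = (X - 1) ^ d * u + C (p : ℤ) * g)
    (hrel : ∏ i ∈ range N, (ClassGroup.mulEquiv (AmbiguousClass.intAut (σ ^ i)) c) ^ (f i) = 1) :
    (∀ m, classGroupPRank κ m ≤ d) ∧ ClassicalMuVanishes κ ∧ classicalLambda κ ≤ d := by
  have hnd := classGroupPRank_le_of_relation_of_classGroupPRank_one_le_one κ hκ hn h1 σ hσ hc hu hF hrel
  have hsmall : classGroupPRank κ (0 + n) < p ^ n - 1 := by rw [Nat.zero_add]; omega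
  have hall : ∀ m, classGroupPRank κ m ≤ d := fun m => by
    have h := classGroupPRank_le_of_lt_pow_sub_one κ hκ le_rfl hsmall m
    rw [Nat.zero_add, Nat.zero_add] at h
    exact h.trans hnd
  exact ⟨hall, classicalLambda_le_of_forall_classGroupPRank_le κ hκ (n := 0) le_rfl (B := d) fun m _ => hall m⟩

end AnyPrime

/-! ## §2 `p = 2`: the first-layer datum from Chevalley's formula — `2 ∤ h_K`, `t₁ ≤ 3`, ONE non-norm unit -/

section Two

variable {K : Type} [Field K] [NumberField K]

/-- ★ **`rank₂ Cl(K_1) + 2 ≤ t₁` from ONE unit of `K` outside `N_{K_1/K} K_1ˣ`** (`κ` a `ℤ₂`-extension of `K`, `h_K` odd, `t₁` the number of primes of `K` ramified in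
`K_1`): the exact genus count `rank₂ Cl(K_1) + 1 + ord₂ [E_K : E_K ∩ N K_1ˣ] = t₁` (tree `classGroupPRank_one_add_one_add_padicValNat_eq_ncard`, Gras IV.4) with the unit
index EVEN (tree `dvd_relIndex_unitsNorm_of_not_mem`). [cite: Gras2003, IV.4] [cite: Lang1990, Ch. 13 §4, Lemma 4.1 (PDF p. 203)] -/
theorem classGroupPRank_one_add_two_le_ncard_of_not_mem (κ : ZpExtension K 2) [NumberField (κ.layer 1)] (hodd : Odd (classNumber K))
    {u : (κ.layer 1)ˣ} (hu : u ∈ unitsE (κ.layer 1) ⊓ (unitsIncl K (κ.layer 1)).range)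
    (hnot : u ∉ (⊤ : Subgroup (κ.layer 1)ˣ).map (Herbrand.norm ((κ.layer 1) ≃ₐ[K] (κ.layer 1)))) :
    classGroupPRank κ 1 + 2 ≤ {v : HeightOneSpectrum (𝓞 K) | v.asIdeal.ramificationIdxIn (𝓞 (κ.layer 1)) ≠ 1}.ncard := by
  classical
  haveI : Fact (Nat.Prime 2) := ⟨Nat.prime_two⟩
  haveI : FiniteDimensional K (κ.layer 1) := κ.finiteDimensional_layer_holds 1
  haveI : IsGalois K (κ.layer 1) := κ.isGalois_layer_holds 1
  have hdeg : Module.finrank K (κ.layer 1) = 2 ^ 1 := κ.finrank_layer_holds 1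
  have hcard : Nat.card ((κ.layer 1) ≃ₐ[K] (κ.layer 1)) = 2 := by rw [IsGalois.card_aut_eq_finrank, hdeg, pow_one]
  haveI : IsCyclic ((κ.layer 1) ≃ₐ[K] (κ.layer 1)) := isCyclic_of_prime_card hcard
  obtain ⟨σ, hσ⟩ := IsCyclic.exists_generator (α := (κ.layer 1) ≃ₐ[K] (κ.layer 1))
  have h := classGroupPRank_one_add_one_add_padicValNat_eq_ncard κ hodd
  have hdvd := dvd_relIndex_unitsNorm_of_not_mem Nat.prime_two hdeg hu hnot
  have hne := (relIndex_unitsNorm_ne_zero hσ).1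
  have h1 : 1 ≤ padicValNat 2 ((unitsE (κ.layer 1) ⊓ (⊤ : Subgroup (κ.layer 1)ˣ).map
      (Herbrand.norm ((κ.layer 1) ≃ₐ[K] (κ.layer 1)))).relIndex (unitsE (κ.layer 1) ⊓ (unitsIncl K (κ.layer 1)).range)) :=
    one_le_padicValNat_of_dvd hne hdvd
  omega

/-- ★ **`rank₂ Cl(K_1) ≤ 1`** when `h_K` is odd, at most THREE primes of `K` ramify in `K_1`, and ONE unit of `K` is not a norm from `K_1`. [cite: Gras2003, IV.4]
[cite: Lang1990, Ch. 13 §4, Lemma 4.1 (PDF p. 203)] -/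
theorem classGroupPRank_one_le_one_of_not_mem (κ : ZpExtension K 2) [NumberField (κ.layer 1)] (hodd : Odd (classNumber K))
    (ht : {v : HeightOneSpectrum (𝓞 K) | v.asIdeal.ramificationIdxIn (𝓞 (κ.layer 1)) ≠ 1}.ncard ≤ 3)
    {u : (κ.layer 1)ˣ} (hu : u ∈ unitsE (κ.layer 1) ⊓ (unitsIncl K (κ.layer 1)).range)
    (hnot : u ∉ (⊤ : Subgroup (κ.layer 1)ˣ).map (Herbrand.norm ((κ.layer 1) ≃ₐ[K] (κ.layer 1)))) :
    classGroupPRank κ 1 ≤ 1 := by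
  have h := classGroupPRank_one_add_two_le_ncard_of_not_mem κ hodd hu hnot
  omega

/-- ★★★ **THE RELATION DOOR AT `p = 2` FROM ONE NON-NORM UNIT AT THE FIRST LAYER (every layer, `μ₂ = 0`, `λ₂ ≤ d`).**  `κ` a `ℤ₂`-extension of `K` with Fukuda index `0`,
`h_K` odd, at most THREE primes of `K` ramified in `K_1`, ONE unit of `K` outside `N_{K_1/K} K_1ˣ`; a layer `n ≥ 1` with `d + 2 ≤ 2^n`, `σ` a generator of `Gal(K_n/K)`,
a class `c ∉ σ(b)·b⁻¹·Cl²` and ONE relation of order `d`.  THEN **`rank₂ Cl(K_m) ≤ d` for every `m`, `μ₂(κ) = 0`, `λ₂(κ) ≤ d`**.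
[cite: Washington1997, §13.3 Prop. 13.22–13.23] [cite: Gras2003, IV.4] [cite: Lang1990, Ch. 13 §4 Lemma 4.1] [cite: Fukuda1994, Thm. 1, p. 264] -/
theorem classicalMuVanishes_and_classicalLambda_le_of_relation_of_not_mem_layer_one (κ : ZpExtension K 2) (hκ : TotallyRamifiedFrom κ 0)
    [NumberField (κ.layer 1)] (hodd : Odd (classNumber K))
    (ht : {v : HeightOneSpectrum (𝓞 K) | v.asIdeal.ramificationIdxIn (𝓞 (κ.layer 1)) ≠ 1}.ncard ≤ 3)
    {u₁ : (κ.layer 1)ˣ} (hu₁ : u₁ ∈ unitsE (κ.layer 1) ⊓ (unitsIncl K (κ.layer 1)).range)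
    (hnot : u₁ ∉ (⊤ : Subgroup (κ.layer 1)ˣ).map (Herbrand.norm ((κ.layer 1) ≃ₐ[K] (κ.layer 1))))
    {n : ℕ} (hn : 1 ≤ n) (σ : (κ.layer n) ≃ₐ[K] (κ.layer n)) (hσ : ∀ τ : (κ.layer n) ≃ₐ[K] (κ.layer n), τ ∈ Subgroup.zpowers σ)
    {c : ClassGroup (𝓞 (κ.layer n))}
    (hc : ¬ ∃ b e : ClassGroup (𝓞 (κ.layer n)), c = ClassGroup.mulEquiv (AmbiguousClass.intAut σ) b / b * e ^ 2)
    {N d : ℕ} (hd : d + 2 ≤ 2 ^ n) {f : ℕ → ℤ} {u g : ℤ[X]} (hu : ¬ (2 : ℤ) ∣ u.eval 1)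
    (hF : (∑ i ∈ range N, C (f i) * X ^ i : ℤ[X]) = (X - 1) ^ d * u + C (2 : ℤ) * g)
    (hrel : ∏ i ∈ range N, (ClassGroup.mulEquiv (AmbiguousClass.intAut (σ ^ i)) c) ^ (f i) = 1) :
    (∀ m, classGroupPRank κ m ≤ d) ∧ ClassicalMuVanishes κ ∧ classicalLambda κ ≤ d := by
  haveI : Fact (Nat.Prime 2) := ⟨Nat.prime_two⟩
  have h1 := classGroupPRank_one_le_one_of_not_mem κ hodd ht hu₁ hnot
  have hu' : ¬ ((2 : ℕ) : ℤ) ∣ u.eval 1 := by exact_mod_cast hu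
  have hF' : (∑ i ∈ range N, C (f i) * X ^ i : ℤ[X]) = (X - 1) ^ d * u + C (((2 : ℕ) : ℤ)) * g := by exact_mod_cast hF
  exact classicalMuVanishes_and_classicalLambda_le_of_relation_of_classGroupPRank_one_le_one κ hκ hn h1 σ hσ hc
    (by exact_mod_cast hd) hu' hF' hrel

end Two

/-! ## §3 `p = 2`, base-field currency: odd degree, `2 ∤ d_K`, at most three primes above `2`, `κ` cyclotomic -/

section Base

variable {K : Type} [Field K] [NumberField K]

set_option maxHeartbeats 800000 in
/-- ★★★ **THE RELATION DOOR ON THE SPLIT STRATUM (any layer, base-field data).**  `K` of odd degree with `2 ∤ d_K` and AT MOST THREE primes above `2`, `κ` a cyclotomic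
`ℤ₂`-extension, `2 ∤ h_K`; a maximal `𝔭' ∋ 2` with `𝓞_K/𝔭' = 𝔽₂` and a unit **`ε ≡ ±3 (mod 𝔭'³)`** (so `ε ∉ N_{K_1/K} K_1ˣ`, `(ε, 2)_{𝔭'} = −1`); a maximal `𝔭 ∋ 2` with
`𝓞_K/𝔭 = 𝔽₂` at which every unit is `≡ ±1 (mod 𝔭³)`, and the GENUS CERTIFICATE `(𝔄, k, π)` for a class `c ∈ Cl(K_m)`, `1 ≤ m` (`N_{K_m/K_1}(c) = [𝔄]`, `N_{K_1/K}(𝔄)^k = (π)`,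
`π ≡ ±3 (mod 𝔭³)`); `σ` a generator of `Gal(K_m/K)`; ONE RELATION `∏_{i<N} σ^i(c)^{f_i} = 1` with `∑ f_i X^i = (X−1)^d·u + 2·g`, `u(1)` odd, **`d + 2 ≤ 2^m`**.  THEN
**`rank₂ Cl(K_l) ≤ d` for every `l`, `μ₂(κ) = 0`, `λ₂(κ) ≤ d`**.  (Fukuda index `0` and `t₁ =` the number of dyadic primes by `2 ∤ d_K`; habitat: `2 = 𝔭₁𝔭₂𝔭₃`, `𝔭' ≠ 𝔭` forced.)
[cite: Washington1997, §13.1 Prop. 13.2, §13.3 Prop. 13.22–13.23] [cite: Gras2003, IV.4] [cite: Lang1990, Ch. 13 §4 Lemma 4.1] [cite: Omeara1963, §63B (63:10)]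
[cite: Fukuda1994, Thm. 1, p. 264] [cite: NeukirchANT1999, Ch. III (2.12)] -/
theorem classicalMuVanishes_two_of_relation_of_genusCert_of_sub_three_mem_layer_one (hK2 : ¬ 2 ∣ Module.finrank ℚ K)
    (hd : ¬ (2 : ℤ) ∣ NumberField.discr K) (κ : ZpExtension K 2) (hκ : κ.IsCyclotomic)
    (h3 : {w : HeightOneSpectrum (𝓞 K) | ((2 : ℕ) : 𝓞 K) ∈ w.asIdeal}.ncard ≤ 3)
    (hh : ¬ 2 ∣ classNumber K) {m : ℕ} (hm : 1 ≤ m)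
    [NumberField (κ.layer 1)] [NumberField (κ.layer m)] [Algebra (κ.layer 1) (κ.layer m)]
    [IsScalarTower K (κ.layer 1) (κ.layer m)]
    (P' : Ideal (𝓞 K)) [P'.IsMaximal] (hres' : ∀ r : 𝓞 K, r ∈ P' ∨ r - 1 ∈ P') (h2P' : (2 : 𝓞 K) ∈ P')
    {ε : (𝓞 K)ˣ} (hε : (ε : 𝓞 K) - 3 ∈ P' ^ 3 ∨ (ε : 𝓞 K) + 3 ∈ P' ^ 3)
    (P : Ideal (𝓞 K)) [P.IsMaximal] (hres : ∀ r : 𝓞 K, r ∈ P ∨ r - 1 ∈ P) (h2P : (2 : 𝓞 K) ∈ P)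
    (hunits : ∀ u : (𝓞 K)ˣ, (u : 𝓞 K) - 1 ∈ P ^ 3 ∨ (u : 𝓞 K) + 1 ∈ P ^ 3)
    {π : 𝓞 K} (hπ : π - 3 ∈ P ^ 3 ∨ π + 3 ∈ P ^ 3)
    {A : Ideal (𝓞 (κ.layer 1))} (hA0 : A ≠ ⊥) {k : ℕ} (hA : Ideal.relNorm (𝓞 K) A ^ k = Ideal.span {π})
    (σ : (κ.layer m) ≃ₐ[K] (κ.layer m)) (hσ : ∀ τ : (κ.layer m) ≃ₐ[K] (κ.layer m), τ ∈ Subgroup.zpowers σ)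
    {c : ClassGroup (𝓞 (κ.layer m))}
    (hcA : classGroupNorm (κ.layer 1) (κ.layer m) c = ClassGroup.mk0 ⟨A, mem_nonZeroDivisors_of_ne_zero hA0⟩)
    {N d : ℕ} (hd2 : d + 2 ≤ 2 ^ m) {f : ℕ → ℤ} {u g : ℤ[X]} (hu : ¬ (2 : ℤ) ∣ u.eval 1)
    (hF : (∑ i ∈ range N, C (f i) * X ^ i : ℤ[X]) = (X - 1) ^ d * u + C (2 : ℤ) * g)
    (hrel : ∏ i ∈ range N, (ClassGroup.mulEquiv (intAut (σ ^ i)) c) ^ (f i) = 1) :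
    (∀ l, classGroupPRank κ l ≤ d) ∧ ClassicalMuVanishes κ ∧ classicalLambda κ ≤ d := by
  classical
  haveI : Fact (Nat.Prime 2) := ⟨Nat.prime_two⟩
  haveI : FiniteDimensional K (κ.layer 1) := κ.finiteDimensional_layer_holds 1
  haveI : IsGalois K (κ.layer 1) := κ.isGalois_layer_holds 1
  have hodd := forall_odd_ramificationIdx_of_not_dvd_discr hd
  have hκ0 : TotallyRamifiedFrom κ 0 := totallyRamifiedFrom_zero_of_forall_odd_ramificationIdx hK2 κ hκ hodd
  have hhodd : Odd (classNumber K) := Nat.odd_iff.mpr (Nat.two_dvd_ne_zero.mp hh)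
  -- the generator certificate at `P`
  have hc := not_exists_eq_conj_div_mul_sq_of_genusCert_layer hK2 hd κ hκ hh m P hres h2P hunits hπ hA0 hA σ hcA
  -- the non-norm unit at `P'`
  obtain ⟨s, hs⟩ := exists_sq_eq_two_layer_one_of_not_dvd_finrank hK2 κ hκ
  have hsK : s ∉ Set.range (algebraMap K (κ.layer 1)) := by
    rintro ⟨k', hk'⟩
    exact forall_algebraMap_ne_of_sq_eq_two hd hs k' hk'
  have h2 : Module.finrank K (κ.layer 1) = 2 := by rw [κ.finrank_layer_holds 1, pow_one]
  have hP'0 : P' ≠ ⊥ := fun h0 => by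
    rw [h0, Ideal.mem_bot] at h2P'
    exact two_ne_zero h2P'
  have h2P'sq : (2 : 𝓞 K) ∉ P' ^ 2 := two_not_mem_sq_of_not_dvd_discr hd P' h2P'
  have hnot : unitsIncl K (κ.layer 1) (Units.map (algebraMap (𝓞 K) K : 𝓞 K →* K) ε) ∉
      (⊤ : Subgroup (κ.layer 1)ˣ).map (Herbrand.norm ((κ.layer 1) ≃ₐ[K] (κ.layer 1))) := by
    rcases hε with h | h
    · exact unitsIncl_unitsMap_not_mem_map_norm_of_sub_three_mem_pow_three h2 hs hsK P' hP'0 hres' h2P' h2P'sq ε h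
    · exact unitsIncl_unitsMap_not_mem_map_norm_of_add_three_mem_pow_three h2 hs hsK P' hP'0 hres' h2P' h2P'sq ε h
  -- `t₁ ≤ 3`
  have ht : {v : HeightOneSpectrum (𝓞 K) | v.asIdeal.ramificationIdxIn (𝓞 (κ.layer 1)) ≠ 1}.ncard ≤ 3 := by
    rw [ncard_ramified_layer_eq_ncard_dyadic hK2 κ hκ hodd le_rfl]
    exact h3
  exact classicalMuVanishes_and_classicalLambda_le_of_relation_of_not_mem_layer_one κ hκ0 hhodd ht
    (unitsIncl_unitsMap_mem_unitsE_inf_range ε) hnot hm σ hσ hc hd2 hu hF hrel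

end Base

/-! ## §4 The first-layer datum from ONE class-number bit: `ord_p h(K_1) ≤ 1` (appended, same gen) -/

section ClassNumber

variable {K : Type} [Field K] [NumberField K] {p : ℕ} [hp : Fact p.Prime]

/-- ★★★ **THE RELATION DOOR FROM `ord_p h(K_1) ≤ 1` (every layer, `μ = 0`, `λ ≤ d`).**  `κ` a `ℤ_p`-extension of `K` with Fukuda index `0`, **`p² ∤ h(K_1)`**
(so `rank_p Cl(K_1) ≤ ord_p h(K_1) ≤ 1`, tree `classGroupPRank_le_classNumberPExp`), a layer `n ≥ 1` with `d + 2 ≤ p^n`, `σ` a generator of `Gal(K_n/K)`, a class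
`c ∉ σ(b)·b⁻¹·Cl^p` and ONE relation of order `d`.  THEN `rank_p Cl(K_m) ≤ d` for every `m`, `μ(κ) = 0`, `λ(κ) ≤ d`.  (At `p = 2` on the cell's split stratum `h(K_1)` is even;
the habitat of this form is `2 ∥ h(K(√2))`.) [cite: Washington1997, §13.3 Prop. 13.22–13.23] [cite: Fukuda1994, Thm. 1, p. 264] [cite: Gras2003, IV.4] -/
theorem classicalMuVanishes_and_classicalLambda_le_of_relation_of_classNumberPExp_one_le_one (κ : ZpExtension K p) (hκ : TotallyRamifiedFrom κ 0)
    {n : ℕ} (hn : 1 ≤ n) (he1 : classNumberPExp κ 1 ≤ 1)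
    (σ : (κ.layer n) ≃ₐ[K] (κ.layer n)) (hσ : ∀ τ : (κ.layer n) ≃ₐ[K] (κ.layer n), τ ∈ Subgroup.zpowers σ)
    {c : ClassGroup (𝓞 (κ.layer n))}
    (hc : ¬ ∃ b e : ClassGroup (𝓞 (κ.layer n)), c = ClassGroup.mulEquiv (AmbiguousClass.intAut σ) b / b * e ^ p)
    {N d : ℕ} (hd : d + 2 ≤ p ^ n) {f : ℕ → ℤ} {u g : ℤ[X]} (hu : ¬ (p : ℤ) ∣ u.eval 1)
    (hF : (∑ i ∈ range N, C (f i) * X ^ i : ℤ[X]) = (X - 1) ^ d * u + C (p : ℤ) * g)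
    (hrel : ∏ i ∈ range N, (ClassGroup.mulEquiv (AmbiguousClass.intAut (σ ^ i)) c) ^ (f i) = 1) :
    (∀ m, classGroupPRank κ m ≤ d) ∧ ClassicalMuVanishes κ ∧ classicalLambda κ ≤ d :=
  classicalMuVanishes_and_classicalLambda_le_of_relation_of_classGroupPRank_one_le_one κ hκ hn
    ((classGroupPRank_le_classNumberPExp κ 1).trans he1) σ hσ hc hd hu hF hrel

end ClassNumber

end Literature.NumberTheory.IwasawaTheory

end
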